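import Mathlib

/-!
# Tier 3 — the Gauss sum of a non-trivial character mod `N` is divisible by `e(1) − 1`

Kernel twin (seat t3-p2, T3.5) for the PRECISION on route/TIER3.md v1.4 §1 item 3 (5) / §3 R-B (v):
the modified Euler factor at the place `w ∣ 𝔭` for a character of conductor `𝔭^a` (`a ≥ 1`) is, with
Kudla's normalised Gauss sum `𝔤(ω, ψ) = q^{−a/2} · g(ω⁻¹, e)`,

  `Eul(χ_w) = χ_w(2ϑ_w) · χ_w(ϖ_w)^{−a} · q_w^{−a/2} · 𝔤(χ_w, ψ)^{−1}
            = χ_w(2ϑ_w) · χ_w(ϖ_w)^{−a} / g(χ_w⁻¹, e)`,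

so its `p`-adic valuation is `−v_p(g(χ_w⁻¹, e))`, NOT `−a/2` in general: only the PRODUCT
`g(χ, e) · g(χ⁻¹, e) = χ(−1) · N` has valuation `a` (`Tier3GaussSumPair.gaussSum_mul_gaussSum_inv_eq_of_isPrimitive`),
while the individual Gauss sum of a non-trivial character is divisible by `e(1) − 1 = ζ_N − 1`
(this file), hence has STRICTLY POSITIVE valuation — so the factor is never a unit (the part of the
claim the chain could use) and its exact valuation depends on `χ_w` (Stickelberger at `a = 1`:
`v_p(g(ω^{−k})) = k/(p − 1)`). The chain uses `≠ 0` only (`Tier3Weierstrass.finite_vanishing_of_interpolation`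
takes `hu : ∀ ν, u ν ≠ 0`).

What is proved here (Mathlib only, no definition):

* `addChar_apply_eq_pow` — `e a = e 1 ^ a.val` for an additive character `e` of `ZMod N`;
* `gaussSum_eq_sum_mul_sub_one` — for `χ ≠ 1`, `g(χ, e) = ∑ a, χ a * (e a − 1)` (the value sum of `χ` vanishes);
* `sub_one_dvd_gaussSum` — for `χ ≠ 1`, `e 1 − 1 ∣ g(χ, e)`;
* `not_isUnit_gaussSum` — if `e 1 − 1` is not a unit of the target domain, neither is `g(χ, e)`;
* `sub_one_sq_dvd_mul_gaussSum_inv` — for `χ ≠ 1`, `(e 1 − 1) ^ 2 ∣ g(χ, e) · g(χ⁻¹, e)` (with the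
  product identity of `Tier3GaussSumPair` this is `(ζ_N − 1)² ∣ χ(−1)·N`, the familiar
  `v_p(g(χ)) + v_p(g(χ⁻¹)) = a` with both summands `> 0`).

Everything is stated for `MulChar (ZMod N) R = DirichletCharacter R N` with `R` a domain, the
vocabulary of `Tier3GaussSumPair`; the `p`-adic valuation reading is the one-line paper remark above.
-/

namespace HodgeRepro.T3.GaussSumDivisibility

open Finset

variable {N : ℕ} [NeZero N] {R : Type*} [CommRing R]

/-- An additive character of `ZMod N` is determined by its value at `1`: `e a = e 1 ^ a.val`. -/
theorem addChar_apply_eq_pow (e : AddChar (ZMod N) R) (a : ZMod N) : e a = e 1 ^ a.val := by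
  have h : a = a.val • (1 : ZMod N) := by
    rw [nsmul_eq_mul, mul_one, ZMod.natCast_zmod_val]
  conv_lhs => rw [h]
  exact AddChar.map_nsmul_eq_pow e a.val 1

/-- `e a − 1` is divisible by `e 1 − 1` (geometric sum). -/
theorem sub_one_dvd_apply_sub_one (e : AddChar (ZMod N) R) (a : ZMod N) : e 1 - 1 ∣ e a - 1 := by
  rw [addChar_apply_eq_pow e a]
  exact sub_one_dvd_pow_sub_one _ _

variable [IsDomain R]

/-- For a non-trivial character the Gauss sum is `∑ a, χ a * (e a − 1)`: the value sum of `χ` vanishes. -/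
theorem gaussSum_eq_sum_mul_sub_one {χ : MulChar (ZMod N) R} (hχ : χ ≠ 1) (e : AddChar (ZMod N) R) :
    gaussSum χ e = ∑ a, χ a * (e a - 1) := by
  simp only [gaussSum, mul_sub, Finset.sum_sub_distrib, mul_one, MulChar.sum_eq_zero_of_ne_one hχ,
    sub_zero]

/-- **Divisibility of the Gauss sum.** For `χ ≠ 1`, `e 1 − 1 ∣ g(χ, e)`. With `e 1 = ζ_N` this is the
statement `g(χ, e) ≡ 0 mod (ζ_N − 1)`, i.e. `v_p(g(χ, e)) ≥ v_p(ζ_N − 1) > 0` for `N = p^a`. -/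
theorem sub_one_dvd_gaussSum {χ : MulChar (ZMod N) R} (hχ : χ ≠ 1) (e : AddChar (ZMod N) R) :
    e 1 - 1 ∣ gaussSum χ e := by
  rw [gaussSum_eq_sum_mul_sub_one hχ e]
  exact Finset.dvd_sum fun a _ => Dvd.dvd.mul_left (sub_one_dvd_apply_sub_one e a) _

/-- If `e 1 − 1` is not a unit of the target domain (e.g. `ζ_{p^a} − 1` in the integers of a
`p`-adic field), then the Gauss sum of a non-trivial character is not a unit either. -/
theorem not_isUnit_gaussSum {χ : MulChar (ZMod N) R} (hχ : χ ≠ 1) (e : AddChar (ZMod N) R)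
    (he : ¬ IsUnit (e 1 - 1)) : ¬ IsUnit (gaussSum χ e) :=
  fun hg => he (isUnit_of_dvd_unit (sub_one_dvd_gaussSum hχ e) hg)

/-- Both Gauss sums `g(χ, e)` and `g(χ⁻¹, e)` are divisible by `e 1 − 1`, so their product is divisible
by `(e 1 − 1) ^ 2`: together with `g(χ, e) · g(χ⁻¹, e) = χ(−1) · N` (`Tier3GaussSumPair`, primitive `χ`)
this is `v_p(g(χ)) + v_p(g(χ⁻¹)) = a` with both summands strictly positive. -/
theorem sub_one_sq_dvd_mul_gaussSum_inv {χ : MulChar (ZMod N) R} (hχ : χ ≠ 1) (e : AddChar (ZMod N) R) :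
    (e 1 - 1) ^ 2 ∣ gaussSum χ e * gaussSum χ⁻¹ e := by
  have hχ' : χ⁻¹ ≠ 1 := by
    intro h
    apply hχ
    simpa using congrArg (fun ψ : MulChar (ZMod N) R => ψ⁻¹) h
  rw [sq]
  exact mul_dvd_mul (sub_one_dvd_gaussSum hχ e) (sub_one_dvd_gaussSum hχ' e)

end HodgeRepro.T3.GaussSumDivisibility

/-!
## Erratum + appendix (v2)

ERRATUM to the module docstring above (v1, landed p403285), recorded on the bus (t3-p2 g7, INBOX L6690):
its sentence «so its `p`-adic valuation is `−v_p(g(χ_w⁻¹, e))`, NOT `−a/2` in general … hence has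
STRICTLY POSITIVE valuation — so the factor is never a unit» OVERCLAIMED — it took
`χ_w(2ϑ_w) · χ_w(ϖ_w)^{−a}` to be a unit. What the theorems above say is about the Gauss sum ALONE:
for `N = p^a` and `χ ≠ 1`, `ζ_N − 1 ∣ g(χ, e)`, so `v_p(g(χ, e)) > 0`, and with the product identity of
`Tier3GaussSumPair` (`g(χ, e) · g(χ⁻¹, e) = χ(−1) · N`, primitive `χ`, `e`)
`v_p(g(χ, e)) + v_p(g(χ⁻¹, e)) = a` with both summands strictly positive. The whole factor
`Eul(χ_w) = χ_w(2ϑ_w) · χ_w(ϖ_w)^{−a} / g(χ_w⁻¹, e)` has valuation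
`v_p(χ_w(2ϑ_w)) − a · v_p(χ_w(ϖ_w)) − v_p(g(χ_w⁻¹, e))`; this file claims nothing about it. (PAPER
remark, not kernel: under Hsieh 2014's printed choice (d2) — Main_Body.tex L103–L107, `2ϑ` prime to
`𝔇 = p𝔠𝔠^c D_{K/F}` — the first term is `0`, the second is an integer multiple of `a` for `deg 𝔭 = 1`,
and `0 < v_p(g) < a` then gives `v_p(Eul(χ_w)) ∉ aℤ`, never a unit. The chain uses `≠ 0` only.)

New in v2 (Mathlib only, no new import — the product identity of `Tier3GaussSumPair` is taken as a
hypothesis so that v1's lines stay byte for byte): `ne_one_of_isPrimitive` (a primitive character mod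
`N ≠ 1` is non-trivial), `mulChar_neg_one_mul_self` and `sub_one_sq_dvd_natCast_of_mul_eq` — for `χ ≠ 1` with
`g(χ, e) · g(χ⁻¹, e) = χ(−1) · N` (`Tier3GaussSumPair.gaussSum_mul_gaussSum_inv_eq_of_isPrimitive` for
primitive `χ`, `e`), `(e 1 − 1) ^ 2 ∣ (N : R)`: from `(e 1 − 1)² ∣ g(χ, e) · g(χ⁻¹, e)` and
`χ(−1) · χ(−1) = 1`. (With `e 1 = ζ_N` this is `(ζ_N − 1)² ∣ N`, the integrality behind
`v_p(g(χ, e)) ≤ a − 1/φ(p^a)`.)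
-/

namespace HodgeRepro.T3.GaussSumDivisibility

variable {N : ℕ} {R : Type*} [CommRing R]

/-- `χ(−1) · χ(−1) = 1` for a multiplicative character of `ℤ/N` (`(χ(−1))² = χ(1) = 1`). -/
theorem mulChar_neg_one_mul_self (χ : MulChar (ZMod N) R) : χ (-1) * χ (-1) = 1 := by
  rw [← map_mul, neg_one_mul, neg_neg, map_one]

variable [NeZero N]

/-- A primitive Dirichlet character modulo `N ≠ 1` is non-trivial (the trivial character has conductor `1`). -/
theorem ne_one_of_isPrimitive (hN : N ≠ 1) {χ : DirichletCharacter R N} (hχ : χ.IsPrimitive) : χ ≠ 1 := by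
  intro h
  subst h
  exact hN (DirichletCharacter.conductor_one.symm.trans ((DirichletCharacter.isPrimitive_def _).mp hχ)).symm

variable [IsDomain R]

/-- `(e 1 − 1) ^ 2 ∣ N` for `χ ≠ 1` satisfying the product identity `g(χ, e) · g(χ⁻¹, e) = χ(−1) · N`
(`Tier3GaussSumPair`, primitive `χ` and `e`): both Gauss sums are divisible by `e 1 − 1`. -/
theorem sub_one_sq_dvd_natCast_of_mul_eq {χ : MulChar (ZMod N) R} (hχ : χ ≠ 1)
    (e : AddChar (ZMod N) R) (hprod : gaussSum χ e * gaussSum χ⁻¹ e = χ (-1) * N) :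
    (e 1 - 1) ^ 2 ∣ (N : R) := by
  have hdvd : (e 1 - 1) ^ 2 ∣ χ (-1) * N := by
    rw [← hprod]
    exact sub_one_sq_dvd_mul_gaussSum_inv hχ e
  have hmul : (N : R) = χ (-1) * (χ (-1) * N) := by
    rw [← mul_assoc, mulChar_neg_one_mul_self, one_mul]
  rw [hmul]
  exact Dvd.dvd.mul_left hdvd _

end HodgeRepro.T3.GaussSumDivisibility
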